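import Mathlib
import Summits.Ventures.PercRepro2.SeriesSplit
import Summits.Ventures.PercRepro2.ParallelSplit

/-! # The flow as a number: `flow = max {k : kDisj k}`, and its series / parallel identities
(seat mine-b, cell pub-perc-repro2)

`flow ends s t S` is the largest `k` with `k` disjoint `s–t` carrying witnesses inside `S`
(`Nat.findGreatest`, bounded by `#S`).  With the splitting lemmas of `SeriesSplit.lean` and
`ParallelSplit.lean`: for parts `E₁`, `E₂` sharing only the cut vertex `v` the flow of a set
`S ⊆ E₁ ∪ E₂` is `min (flow (S ∩ E₁)) (flow (S ∩ E₂))` (`flow_series`), and for parts sharing only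
the terminals it is the sum (`flow_parallel`) — the numerical product-family dictionary. -/

open Finset
namespace Summit.Ventures.PercRepro2

section FlowNat

variable {V : Type*} {E : Type*} [DecidableEq E]

omit [DecidableEq E] in
/-- `k + 1` disjoint witnesses contain `k` (take the second component). -/
lemma kDisj_drop (A : Finset E → Prop) (k : ℕ) {S : Finset E} (h : kDisj A (k + 1) S) :
    kDisj A k S := by
  obtain ⟨_, L, _, hL, _, _, hB⟩ := h
  exact hB S hL

omit [DecidableEq E] in
/-- antitone in `k` -/
lemma kDisj_of_le (A : Finset E → Prop) {j k : ℕ} (hjk : j ≤ k) {S : Finset E} (h : kDisj A k S) :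
    kDisj A j S := by
  induction k with
  | zero => have : j = 0 := by omega
            subst this; exact h
  | succ k ih =>
      rcases Nat.lt_or_ge j (k + 1) with hlt | hge
      · exact ih (by omega) (kDisj_drop A k h)
      · have : j = k + 1 := by omega
        subst this; exact h

/-- a set carrying `s–t` with `s ≠ t` has an edge -/
lemma carries_nonempty {ends : E → Sym2 V} {s t : V} (hst : s ≠ t) {K : Finset E}
    (hc : Carries ends K s t) : K.Nonempty := by
  obtain ⟨w⟩ := hc
  cases w with
  | nil => exact absurd rfl hst
  | cons hadj _ =>
    rw [openGraph_adj] at hadj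
    obtain ⟨_, e, heopen, _⟩ := hadj
    exact ⟨e, ofFinset_eq_true_iff.1 heopen⟩

/-- `k` disjoint carrying witnesses need `k` edges -/
lemma kDisj_card_bound {ends : E → Sym2 V} {s t : V} (hst : s ≠ t) :
    ∀ (k : ℕ) {S : Finset E}, kDisj (fun S => Carries ends S s t) k S → k ≤ S.card
  | 0, _, _ => Nat.zero_le _
  | k + 1, S, h => by
      obtain ⟨K, L, hK, hL, hKL, hA, hB⟩ := h
      have hKne : K.Nonempty := carries_nonempty hst (hA K le_rfl)
      have hk : k ≤ L.card := kDisj_card_bound hst k (hB L le_rfl)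
      have hcard : K.card + L.card ≤ S.card := by
        rw [← Finset.card_union_of_disjoint hKL]
        exact Finset.card_le_card (Finset.union_subset hK hL)
      have : 1 ≤ K.card := Finset.card_pos.2 hKne
      omega

/-- The flow of the edge set `S` from `s` to `t`: the largest number of disjoint carrying witnesses. -/
noncomputable def flow (ends : E → Sym2 V) (s t : V) (S : Finset E) : ℕ :=
  @Nat.findGreatest (fun k => kDisj (fun S => Carries ends S s t) k S) (Classical.decPred _) S.card

/-- the flow is attained -/
lemma kDisj_flow (ends : E → Sym2 V) (s t : V) (S : Finset E) :
    kDisj (fun S => Carries ends S s t) (flow ends s t S) S := by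
  unfold flow
  classical
  exact Nat.findGreatest_spec (P := fun k => kDisj (fun S => Carries ends S s t) k S)
    (Nat.zero_le _) trivial

/-- any number of disjoint witnesses is at most the flow -/
lemma le_flow {ends : E → Sym2 V} {s t : V} (hst : s ≠ t) {k : ℕ} {S : Finset E}
    (h : kDisj (fun S => Carries ends S s t) k S) : k ≤ flow ends s t S := by
  unfold flow
  classical
  exact Nat.le_findGreatest (kDisj_card_bound hst k h) h

/-- monotone in the edge set -/
lemma flow_mono {ends : E → Sym2 V} {s t : V} (hst : s ≠ t) {S T : Finset E} (h : S ⊆ T) :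
    flow ends s t S ≤ flow ends s t T :=
  le_flow hst (incr_kDisj _ _ h (kDisj_flow ends s t S))

/-- **series identity**: for parts sharing only the cut vertex `v` (`s` touched only by `E₁`, `t`
only by `E₂`), the flow of `S ⊆ E₁ ∪ E₂` is the minimum of the flows of its two halves -/
theorem flow_series {ends : E → Sym2 V} {s v t : V} {E₁ E₂ : Finset E}
    (hE : SharesOnlyVertex ends v E₁ E₂) (hs : ∀ e ∈ E₂, s ∉ ends e) (ht : ∀ e ∈ E₁, t ∉ ends e)
    (hsv : s ≠ v) (htv : t ≠ v) (hst : s ≠ t) (hdisj : Disjoint E₁ E₂) {S : Finset E}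
    (hS : S ⊆ E₁ ∪ E₂) :
    flow ends s t S = min (flow ends s v (S ∩ E₁)) (flow ends v t (S ∩ E₂)) := by
  apply le_antisymm
  · obtain ⟨h₁, h₂⟩ := kDisj_series_split hE hs ht hsv htv hst _ hS (kDisj_flow ends s t S)
    exact le_min (le_flow hsv h₁) (le_flow (Ne.symm htv) h₂)
  · set m := min (flow ends s v (S ∩ E₁)) (flow ends v t (S ∩ E₂)) with hm
    have h₁ : kDisj (fun S => Carries ends S s v) m (S ∩ E₁) :=
      kDisj_of_le _ (min_le_left _ _) (kDisj_flow ends s v (S ∩ E₁))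
    have h₂ : kDisj (fun S => Carries ends S v t) m (S ∩ E₂) :=
      kDisj_of_le _ (min_le_right _ _) (kDisj_flow ends v t (S ∩ E₂))
    have hd : Disjoint (S ∩ E₁) (S ∩ E₂) :=
      Finset.disjoint_of_subset_left Finset.inter_subset_right
        (Finset.disjoint_of_subset_right Finset.inter_subset_right hdisj)
    have hu : S ∩ E₁ ∪ S ∩ E₂ = S := by
      rw [← Finset.inter_union_distrib_left]
      exact Finset.inter_eq_left.2 hS
    have := kDisj_series_merge m hd h₁ h₂
    rw [hu] at this
    exact le_flow hst this

/-- **parallel identity**: for parts sharing only the terminals, the flow of `S ⊆ E₁ ∪ E₂` is the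
sum of the flows of its two halves -/
theorem flow_parallel [DecidableEq V] {ends : E → Sym2 V} {s t : V} {E₁ E₂ : Finset E}
    (hE : SharesOnlyPair ends s t E₁ E₂) (hst : s ≠ t) (hdisj : Disjoint E₁ E₂) {S : Finset E}
    (hS : S ⊆ E₁ ∪ E₂) :
    flow ends s t S = flow ends s t (S ∩ E₁) + flow ends s t (S ∩ E₂) := by
  apply le_antisymm
  · obtain ⟨k₁, k₂, hk, h₁, h₂⟩ := kDisj_parallel_split hE hst _ hS (kDisj_flow ends s t S)
    rw [← hk]
    exact Nat.add_le_add (le_flow hst h₁) (le_flow hst h₂)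
  · have hd : Disjoint (S ∩ E₁) (S ∩ E₂) :=
      Finset.disjoint_of_subset_left Finset.inter_subset_right
        (Finset.disjoint_of_subset_right Finset.inter_subset_right hdisj)
    have hu : S ∩ E₁ ∪ S ∩ E₂ = S := by
      rw [← Finset.inter_union_distrib_left]
      exact Finset.inter_eq_left.2 hS
    have := kDisj_parallel_merge _ hd (kDisj_flow ends s t (S ∩ E₁)) (kDisj_flow ends s t (S ∩ E₂))
    rw [hu] at this
    exact le_flow hst this

end FlowNat

end Summit.Ventures.PercRepro2
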